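import Summits.SmoothPoincare4.SmoothPoincare4.Theorems.ConvexBisectionAcyclicBisectionExistsHurwitzReduction
import Summits.SmoothPoincare4.SmoothPoincare4.Theorems.ConvexBisectionAcyclicBisectionExistsPageInvariance
import Summits.SmoothPoincare4.SmoothPoincare4.Theorems.ConvexBisectionAcyclicBisectionExistsPageInvarianceTwisting
import Summits.SmoothPoincare4.SmoothPoincare4.Theorems.ConvexBisectionAcyclicBisectionExistsPageTwistingTransverseLoop
import Summits.SmoothPoincare4.SmoothPoincare4.Theorems.ConvexBisectionAcyclicBisectionExistsPageRotationFlowFix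
import Literature.Topology.FourManifolds.GluingProofs
import HarnessLib

/-!
# NF4 DESIGN (worker W6, lead c5, wave 1, 2026-08-17) — `stub_modelsOnFibred_of_reach`
# (= `Literature.Topology.FourManifolds.LefschetzBase.modelsOnFibred_of_reach`), line `modp-braid-orbits`,
# crux `ConvexBisection.AcyclicBisectionExists` (stmt-SmoothPoincare4-10508)

`lean check`: rc 0, `sorry` exactly in the NODE theorems `node_*` (6 sorries: N1 M2-geo, N2 BELT,
N1a M3c, N3 ST-geo, N3a ST-curve, N3b ST-embed); everything else PROVED, the top theorem
`nf4_design` has the registered NF4 signature verbatim and is proved from p114135's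
`stub_modelsOnFibred_of_reach_of_front` + (HS) + (ST-front), where
  (HS)       = `hs_design`  := p134969 `hurwitzStep_of_redecomposition (redecomposition_of_geometric_of_belt N1 N2)`,
  (ST-front) = `st_design`  := `frontStab_of_rebuild N3` (proved here; lands as p-file 2 `…StabRebuildReduction`).

## VERDICT on NF4 as registered: (i)* — TRUE, provable WITHOUT the full Kas dictionary and without
## Laudenbach–Poénaru, BUT NOT through the same-seam shear (M2) of Report-r11-NF4 §4, which is obstructed.

(a) `HurwitzStep` (SignedHurwitzAction.lean) acts on LIST POSITIONS: `l = pre ++ a :: b :: suf ↦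
pre ++ (t_a^{ε_a} b, ε_b) :: a :: suf` or `pre ++ b :: (t_b^{-ε_b} a, ε_a) :: suf`; the word length `n`
and hence the SET of directions `{pageDir n k}` are unchanged — only the assignment letter ↦ position
changes (confirmed against the definition; `HurwitzStep.length_eq`).  So (HS) needs no re-spacing
(lead's rigidity finding applies only to (ST)).  `StabStep`/front: `n ↦ n + 4`, `g ↦ g + 1`: EVERY
direction and the cap change — (ST-front) is a REBUILD over `Base (g+1)` (N3), never a deformation:
by the lead's rigidity (page clause binds at seam points arbitrarily close to the binding, so a
binding-preserving smooth map has a projectively linear angle map at `w = 0`, which cannot send the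
`n` equally spaced old directions to `n` of `n + 4` equally spaced new ones for `n = 2` and all
`n ≥ 4` — antipodal pairs for even `n`, the cross-ratio of four directions for odd `n ≥ 5`).

(b) OBSTRUCTION to the same-seam (M2) `exists_shear_redecomposition` of Report §4 (its last clause
"`∀ a' ∈ ∂, ∃ a c, D'.jA a' = D.jA a ∧ w a' = c w a`", i.e. new seam ⊆ old seam, same `X`):
 1. `∂X ∖ seam = ⊔ₖ βₖ` (the `n` deep belt circles `D.jB k (∂𝔻⁴ ∖ T)`), likewise for `D'`; new seam ⊆
    old seam and `n = n` force `⊔ β' = ⊔ β`, so `τ := jA⁻¹ ∘ jA'` is a page- and binding-preserving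
    homeomorphism `∂Base g ∖ cores' → ∂Base g ∖ cores` (dense open subsets).
 2. For a page angle `θ` not among the `θₖ := arg pageDir n k`, `τ` restricts to a homeomorphism `T_θ`
    of the full page; `θ ↦ (T_θ)_* ∈ Aut H₁(F)` (`H₁(page) ≅ H₁(Base g)`, shadow) is constant on each
    arc of `S¹ ∖ {θₖ}` (continuity in `θ`).
 3. At `θₖ`, with old core `γ` (class `[γ]`) and new core `γ'` in that page: `T_θ → T_{θₖ}` locally
    uniformly on `F ∖ γ'` as `θ → θₖ`, `T_{θₖ} : F ∖ γ' ≅ F ∖ γ`; hence for `θ` near `θₖ` the annulus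
    `T_θ(A(γ'))` contains `γ` in its interior, so `T_θ(γ') ≃ ±γ` and `(T_θ)_*[γ'] = ±[γ]` (γ essential).
 4. Example `g = 1`, `stdSymp a b = 1`, `l = [(a,+),(b,+),(a,+)]`, move at `(0,1)`, first disjunct:
    `l' = [(a+b,+),(a,+),(a,+)]`.  On the arc between `θ₂` and `θ₁` the single automorphism `ψ` must
    satisfy `ψ a = ±b` (page `θ₁`: new class `a`, old class `b`) and `ψ a = ±a` (page `θ₂`: classes
    `a`, `a`) — contradiction.  Second disjunct: `ψ(a+b) = ±b`, `ψ a = ±a` on that arc, and across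
    `θ₂` (jump by a power of `t_a`) `ψ'(b) = ±a` on the next arc — contradiction again.
    So no `D'` with that seam clause exists, for ANY `X`; (HS) cannot be fed to `modelsOnFibred_of_data`
    with the literal old seam.  What the honest Hurwitz move gives (Gompf–Stipsicz §8.2 re-read through
    Kas: keep the Lefschetz fibration, exchange the two critical values by a half twist of the base
    disc supported off `∂D` and off the centre, re-present by Kas): the same `X` (or any `X' ≅ X`) with
    NEW deep belts for the two moved handles (= outward vanishing cycles, transported through the free
    sector of `∂X`), the unchanged open book `θ_X` on `∂X`, and new seam points landing on OLD BELTS.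
    Hence the transfer form N1 (dichotomy seam/belt) + the continuity clause N2 (BELT), assembled by
    p134969 through `modelsOnFibred_of_transfer` (p128002 T3).
(c) A further impossibility worth recording for wave 2: there is NO page-preserving diffeomorphism
    of `∂ Base g` equal to a Dehn twist on the pages of a sector and to the identity elsewhere (the
    page class is locally constant in `θ`); pagewise Dehn twists of `Base g` are `t_a × id` on ALL
    pages (this is the `τ` of N1a), and the class change `b ↦ t_a^{±} b` of the moved handle comes
    from crossing the belt page of `a` inside `∂X`, not from a diffeomorphism of `Base g`.
(d) Why not (ii) "full Kas dictionary": N1 only needs the one-move slice (an open-book-exact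
    self-re-presentation of ONE handlebody), never the equivalence "fibred model ⇔ ALF on
    `M ∖ S¹ × D³`"; N3 needs a rebuild inside the cap (`M ≅ M # S⁴ # S⁴` by explicit pieces), no LP.
(e) (iii) not supported: no seam-pair obstruction to NF4 itself was found — the rigid clauses
    (`mem_page` in flat pages at `pageDir`, page clause up to the binding with `c > 0`) are all
    re-established by the rebuilds; the hidden regularity they impose on witnesses (the open book
    `θ_X = arg w ∘ Ψ` is smooth across the deep belts) is carried into N1/N3 by keeping `Ψ` among
    the hypotheses (a `Ψ`-free N1 over arbitrary Kosinski data would be FALSE for irregular tubes).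

## NODE TABLE (Lean names below; sizes = honest estimates, lines of Lean)

* N1  `node_M2geo`   (HS core, transfer form, Ψ-certified)      XL  2500–4000  [GS1999 §8.2; Kas1980 §2]
      produces: `IsLefschetzLink g l' h'` + the seam/belt dichotomy for `G`  (→ page clause via N2)
      internal plan: N1-rot (free rotation of one handle inside a free sector, fibred: report §3.2,
      NF6 `helper_rotFlow_fix` p-landed, `pageTwisting_transport_eq_of_fibred` p132432,
      `shadow_comp_ambientIsotopy` p131188) 600–900; N1-cross (crossing the belt page of the adjacent
      handle inside `∂(Base g ∪ h_adj)`: localisation of the open-book monodromy of `∂X` at a deep belt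
      as `t_γ^{∓pageTwisting}` off a thin annulus, transport of the other attaching torus through it,
      `IsMultiAttachment.isAttachment_lift_iff` / ISO `isMultiAttachment_of_linkIsotopyInBoundary_holds`
      for the 4-dimensional side) 1500–2500; N1a (M3c) for the new shadow 400–600; twisting by
      `pageTwisting_transport_eq_of_fibred`; link assembly + `pageDir` bookkeeping (§0) 200–300.
* N1a `node_M3c_shadow_pageDehnTwist`  (Picard–Lefschetz on shadows)  M  400–600  [FarbMargalit Prop 6.3;
      conventions (a)–(c) of LefschetzBasePages + p114135 audit: right-turning ↔ `true`]
* N2  `node_BELT`    (page clause extends to the deep belts)     S–M 300–500   [folklore; Kosinski VI §6]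
      produces: the belt half of the new page clause.  Tools: `MultiAttachmentData.glue/cover`,
      `handleInversion` asymptotics (`lamSq → 1 ↔ belt`), continuity of `Ψ`, `w`; the binding circle
      `{w = 0} ∩ ∂Base g` is a topological circle (connected double cover of `‖x‖ = R`), so the injective
      `Ψ ∘ jA|binding` is onto and `Ψ(belt)` misses the binding.
* N3  `node_STgeo`   (front stabilisation = rebuild over `Base (g+1)`)  XXL 4000–6000
      [EtnyreFuller2006 §2 p. 5; Baykur2006 Lemma 1, §5 p. 13; GS1999 §8.2; Kirby calculus of `M # S⁴`]
      produces: ALL clauses of `ModelsOnFibred M (g+1) l''` (link, gluing via `exists_isBoundaryGluing_holds`,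
      page clause) + `M ≅ M''`.  Internal plan: N3a curves (600–1000), N3b page embedding `g ↦ g+1`
      (500–900), N3c attaching maps with prescribed core and page twisting `∓1` (400–800; cf.
      `Literature.Geometry.Symplectic.AttachingFramingProofs`), N3d the cap cobordism
      `Base g = K ∪ Base (g+1)'`, `K = collar ∪ 2 one-handles ∪ 4 two-handles` with the fibred
      identification of `∂_in K` and `Ψ'' := ∂(…)`, `X'' := X ∪_Ψ K` a multi-attachment of `h''`
      (2500–3500; `IsBoundaryGluing.transfer`, `MultiAttachmentData.isMultiAttachment_cons`,
      gluing associativity files `Gluing*`).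
* N3a `node_STcurve`  (primitive classes are shadows of embedded page curves)  M 600–1000 [FM Prop 6.2; Milnor §9]
* N3b `node_STembed`  (pages of `Base g` embed in pages of `Base (g+1)` with shadow `embed`) M 500–900 [Milnor §9]

Registered/landed by W6: p134969 `…HurwitzReduction.lean` (`helper_hurwitzStep_of_redecomposition`,
`helper_mem_boundary_of_incl_eq_jA`, `pageClause_transfer_of_dichotomy`,
`redecomposition_of_geometric_of_belt`); file 2 `…StabRebuildReduction.lean`
(`helper_frontStab_of_rebuild`, `helper_modelsOnFibred_of_reach_of_nodes`) proposed after p134969.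
-/

noncomputable section

set_option linter.dupNamespace false

open scoped Manifold ContDiff Topology Real
open Set Function

namespace Summit.SmoothPoincare4.SmoothPoincare4.Theorems.AcyclicBisectionExists.ModpBraidOrbits

namespace NF4Design

open Literature.GroupTheory.CombinatorialGroupTheory.SignedHurwitz
open Literature.Topology.FourManifolds Literature.Topology.FourManifolds.LefschetzBase
open Literature.Topology.FourManifolds.HandleAttachingMap
open ModelsOnFibredOfReach

/-! ## §0 Bookkeeping (PROVED): positions and page directions -/

/-- The exponent of `pageDir n k` as a real number. [folklore] -/
theorem pageDir_eq_exp (n k : ℕ) :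
    pageDir n k = Complex.exp (((-(2 * π * (k + 1 / 2) / n) : ℝ)) * Complex.I) := rfl

/-- **Distinct positions give distinct page directions**: `pageDir n` is injective on `k < n`
(the angles `-2π(k + ½)/n`, `k < n`, are pairwise incongruent mod `2π`).  Used with `disjoint_page`:
attaching circles of different positions lie in disjoint pages. [folklore] -/
theorem pageDir_injOn {n k₁ k₂ : ℕ} (h₁ : k₁ < n) (h₂ : k₂ < n) (h : pageDir n k₁ = pageDir n k₂) :
    k₁ = k₂ := by
  have hn : (0 : ℝ) < n := by exact_mod_cast (Nat.lt_of_le_of_lt (Nat.zero_le _) h₁)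
  rw [pageDir_eq_exp, pageDir_eq_exp, Complex.exp_eq_exp_iff_exists_int] at h
  obtain ⟨m, hm⟩ := h
  -- compare real coefficients of `I`
  have hre : (-(2 * π * (k₁ + 1 / 2) / n) : ℝ) = -(2 * π * (k₂ + 1 / 2) / n) + m * (2 * π) := by
    have := congrArg Complex.im hm
    simpa using this
  have hk : (k₂ : ℝ) - k₁ = m * n := by
    field_simp at hre
    nlinarith [Real.pi_pos]
  have hk' : (k₂ : ℤ) - k₁ = m * n := by exact_mod_cast hk
  have hb : |(k₂ : ℤ) - k₁| < n := by
    rw [abs_lt]; constructor <;> omega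
  rw [hk', abs_mul, Nat.abs_cast] at hb
  have hm0 : m = 0 := by
    by_contra hmne
    have : (1 : ℤ) * n ≤ |m| * n :=
      mul_le_mul_of_nonneg_right (Int.one_le_abs hmne) (by positivity)
    omega
  subst hm0
  simp at hk'
  omega

/-- Attaching circles at different positions of a Lefschetz link lie in DISJOINT pages. [folklore] -/
theorem IsLefschetzLink.disjoint_pages {g : ℕ} {l : IntWord g}
    {h : Fin l.length → HandleAttachingMap 3 2 (Base g)} (_hl : IsLefschetzLink g l h)
    {i j : Fin l.length} (hij : i ≠ j) :
    Disjoint (page g (pageDir l.length i)) (page g (pageDir l.length j)) :=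
  disjoint_page g fun heq => hij (Fin.ext (pageDir_injOn i.2 j.2 heq))

/-- A signed Hurwitz move keeps the length (hence the set of page directions). [folklore] -/
theorem hurwitzStep_length {g : ℕ} {l l' : IntWord g} (h : HurwitzStep (stdSymp ℤ g) l l') :
    l'.length = l.length := by
  obtain ⟨pre, suf, a, b, rfl, h'⟩ := h
  rcases h' with rfl | rfl <;> simp

/-! ## §1 The Hurwitz side: nodes N1 (M2-geo), N1a (M3c), N2 (BELT) -/

/-- **N1 (M2-geo) — one signed Hurwitz move as an open-book-exact re-decomposition, transfer form.**
Informal content: given fibred data `(X, h, D, bX, Ψ)` of word `l` (Lefschetz link over `Base g`,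
Kosinski multi-attachment data, boundary datum, PAGE-PRESERVING gluing map — the certificate that the
seam open book of `∂X` closes up and is smooth across the deep belts) and `l ↝ l'` one signed Hurwitz
move (positions `i, i+1`; no re-spacing: same `pageDir n ·`), there are a Lefschetz link `h'` of `l'`,
data `D'` on a compact `X'` and `G : X ≅ X'` such that every new boundary seam point `D'.jA a'` is sent
by `G⁻¹` EITHER to an old seam point `D.jA a` on the same `w`-ray (`w a' = c · w a`, `c > 0`; binding to
binding) OR to a deep point `D.jB k b ∉ range D.jA` (a point of the `k`-th belt circle) with
`w a' ∈ ℝ_{>0} · pageDir n k`.  Geometric source: Gompf–Stipsicz 1999 §8.2 (Hurwitz move = same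
fibration, new arcs; on the handlebody: slide of one Lefschetz handle over the adjacent one), Kas 1980
§2; the new deep belts of the two moved handles are NOT the old ones (they are the old belts
transported through the free sector of the open book of `∂X`), all other structure of `∂X` is kept.
Produces: `IsLefschetzLink g l' h'` (clauses `disjoint/mem_page/shadow_eq/twisting_eq`, the last two
by N1a and `pageTwisting_transport_eq_of_fibred` p132432, `shadow_comp_ambientIsotopy` p131188) and
the dichotomy consumed by `pageClause_transfer_of_dichotomy` (p134969).  Size XL (2500–4000 lines).
Tools: `helper_rotFlow_fix` (NF6, rotation inside a sector), ISO
`isMultiAttachment_of_linkIsotopyInBoundary_holds`, `MultiAttachmentData.isAttachment_lift_iff`,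
`IsMultiAttachment.transport`, §0. [cite: GompfStipsicz1999, §8.2] -/
theorem node_M2geo :
    ∀ (g : ℕ) (l l' : IntWord g), HurwitzStep (stdSymp ℤ g) l l' →
      ∀ (X : Type) [TopologicalSpace X] [T2Space X] [SecondCountableTopology X] [CompactSpace X]
        [ChartedSpace (EuclideanHalfSpace 4) X] [IsManifold (𝓡∂ 4) ∞ X]
        (h : Fin l.length → HandleAttachingMap 3 2 (Base g))
        (D : MultiAttachmentData h (𝓡∂ 4) X) (bX : BoundaryData (𝓡∂ 4) X (𝓡 3))
        (Ψ : bX.carrier ≃ₘ⟮𝓡 3, 𝓡 3⟯ (bBase g).carrier),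
        IsLefschetzLink g l h →
        (∀ (y : bX.carrier) (a : ↥(coresComplement h)), bX.incl y = D.jA a →
          ∃ c : ℝ, 0 < c ∧ w g ((bBase g).incl (Ψ y)).1 = (c : ℂ) * w g (a : Base g).1) →
        ∃ (X' : Type) (_ : TopologicalSpace X') (_ : T2Space X') (_ : SecondCountableTopology X')
          (_ : CompactSpace X') (_ : ChartedSpace (EuclideanHalfSpace 4) X')
          (_ : IsManifold (𝓡∂ 4) ∞ X') (h' : Fin l'.length → HandleAttachingMap 3 2 (Base g))
          (D' : MultiAttachmentData h' (𝓡∂ 4) X') (G : X ≃ₘ⟮𝓡∂ 4, 𝓡∂ 4⟯ X'),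
          IsLefschetzLink g l' h' ∧
          ∀ a' : ↥(coresComplement h'), G.symm (D'.jA a') ∈ (𝓡∂ 4).boundary X →
            (∃ a : ↥(coresComplement h), G.symm (D'.jA a') = D.jA a ∧
              ∃ c : ℝ, 0 < c ∧ w g (a' : Base g).1 = (c : ℂ) * w g (a : Base g).1) ∨
            (∃ (k : Fin l.length) (b : ↥(beltPiece 3 2)), G.symm (D'.jA a') = D.jB k b ∧
              G.symm (D'.jA a') ∉ range D.jA ∧
              ∃ c : ℝ, 0 < c ∧ w g (a' : Base g).1 = (c : ℂ) * pageDir l.length k) := by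
  sorry

/-- **N1a (M3c) — Picard–Lefschetz on shadows for a page Dehn twist.**  Informal content: let `τ` be
a self-map of `Base g` which on the page of direction `c` is a RIGHT-handed (`s = true`) resp.
LEFT-handed (`s = false`) Dehn twist along the embedded page curve `a`, presented in an oriented
annulus chart `φ : ℝ × ℝ → page` (`u` the 1-periodic coordinate along `a`, `r` the transverse one,
`∂_r φ` on the `cplxJ (∂_u φ)` side = positive for the complex orientation of the page) as the shear
`(u, r) ↦ (u ± β r, r)` (`β = 0` for `r ≤ -1/2`, `β = 1` for `r ≥ 1/2`), and the identity on the rest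
of the page.  Then for every loop `K` in that page, `shadow (τ ∘ K) = transvection (shadow a, s)
(shadow K) = shadow K + sgn s · stdSymp (shadow a) (shadow K) · shadow a`.  Source: Farb–Margalit,
Primer, Prop. 6.3 (`T_a(b) = b + î(a,b) a`) with conventions (a)–(c) of `LefschetzBasePages.lean` (the
`A_{2g}` chain is a `+1`-chain for the complex orientation, so `î ↦ stdSymp` under `shadowMap`) and
the audit of p114135 (right-turning ↔ `true`).  AUDIT POINT: the pairing `s ↔ ±β`.  Used inside N1
(class of the moved handle after crossing the belt page of `a`) and N3 (classes of curves obtained by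
twisting).  Size M (400–600 lines; through `IsChainShadow`/`exists_isChainShadow_holds` p120043,
`loopClass` additivity `HurewiczOne`, `shadow_eq_of_homotopic` p131188). [cite: GompfStipsicz1999, §8.2] -/
theorem node_M3c_shadow_pageDehnTwist (g : ℕ) {c : ℂ} (_hc : ‖c‖ = 1) (τ : Base g → Base g)
    (hτ : Continuous τ) {a : Metric.sphere (0 : EuclideanSpace ℝ (Fin 2)) 1 → Base g}
    (ha : Continuous a) (s : Bool) (φ : ℝ × ℝ → Base g) (β : ℝ → ℝ)
    (_hφs : ContMDiff 𝓘(ℝ, ℝ × ℝ) (𝓡∂ 4) ∞ φ) (_hφ1 : ∀ u r, φ (u + 1, r) = φ (u, r))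
    (_hφa : ∀ u, φ (u, 0) = a (circlePt u)) (_hφp : ∀ p, φ p ∈ page g c)
    (_hφi : InjOn φ (Ico (0 : ℝ) 1 ×ˢ Ioo (-1 : ℝ) 1))
    (_hφo : ∀ u r, r ∈ Ioo (-1 : ℝ) 1 →
      0 < inner ℝ (deriv (fun r' => (φ (u, r')).1) r) (cplxJ (deriv (fun u' => (φ (u', r)).1) u)))
    (_hβs : ContDiff ℝ ∞ β) (_hβ0 : ∀ r ≤ -(1 / 2 : ℝ), β r = 0) (_hβ1 : ∀ r ≥ (1 / 2 : ℝ), β r = 1)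
    (_hτon : ∀ u r, r ∈ Ioo (-1 : ℝ) 1 →
      τ (φ (u, r)) = φ (u + (if s then β r else -β r), r))
    (_hτoff : ∀ p ∈ page g c, p ∉ φ '' (univ ×ˢ Ioo (-1 : ℝ) 1) → τ p = p)
    {K : Metric.sphere (0 : EuclideanSpace ℝ (Fin 2)) 1 → Base g} (hK : Continuous K)
    (_hKc : ∀ θ, K θ ∈ page g c) :
    shadow g (τ ∘ K) (hτ.comp hK) = transvection (stdSymp ℤ g) (shadow g a ha, s) (shadow g K hK) := by
  sorry

/-- **N2 (BELT) — the page clause extends by continuity from the seam to the deep belt circles.**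
Informal content: in fibred data `(X, h, D, bX, Ψ)` the boundary points of `X` NOT on the seam
`D.jA(∂Base g ∖ cores)` are the `n` belt circles `D.jB k {x_λ = 0, ‖x‖ = 1}`; a point of the `k`-th one
is the limit of seam points `D.jA (h k (α b_m))`, `α b_m → S` (Kosinski's inversion), whose base points
converge into the attaching circle `⊂ page (pageDir n k)` (`w = pageDir n k / 2`); continuity of `Ψ`
and `w` gives `w (Ψ y) = c · pageDir n k` with `c ≥ 0`, and `c > 0` because `Ψ(belt)` misses the
binding: `Ψ ∘ D.jA` maps the binding circle `{w = 0} ∩ ∂Base g` (a connected double cover of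
`‖x‖ = R`, a topological circle) injectively, hence ONTO itself.  Produces: the belt half of the new
page clause in `pageClause_transfer_of_dichotomy` (p134969).  Source: folklore (Kosinski 1993 VI §6
for the model).  Size S–M (300–500 lines).  Tools: `MultiAttachmentData.glue/cover`,
`handleInversion_mem`, `lamSq_handleInversion`, `attachingCircle`, `exists_coreTubePt_eq`,
`BoundaryData.isSmoothEmbedding` (closed embedding ⇒ sequences lift), compactness of `Base g`.
[cite: Kosinski1993, VI §6] -/
theorem node_BELT :
    ∀ (g : ℕ) (l : IntWord g) (X : Type) [TopologicalSpace X] [T2Space X]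
      [SecondCountableTopology X] [CompactSpace X] [ChartedSpace (EuclideanHalfSpace 4) X]
      [IsManifold (𝓡∂ 4) ∞ X] (h : Fin l.length → HandleAttachingMap 3 2 (Base g))
      (D : MultiAttachmentData h (𝓡∂ 4) X) (bX : BoundaryData (𝓡∂ 4) X (𝓡 3))
      (Ψ : bX.carrier ≃ₘ⟮𝓡 3, 𝓡 3⟯ (bBase g).carrier),
      IsLefschetzLink g l h →
      (∀ (y : bX.carrier) (a : ↥(coresComplement h)), bX.incl y = D.jA a →
        ∃ c : ℝ, 0 < c ∧ w g ((bBase g).incl (Ψ y)).1 = (c : ℂ) * w g (a : Base g).1) →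
      ∀ (y : bX.carrier) (k : Fin l.length) (b : ↥(beltPiece 3 2)), bX.incl y = D.jB k b →
        bX.incl y ∉ range D.jA →
        ∃ c : ℝ, 0 < c ∧ w g ((bBase g).incl (Ψ y)).1 = (c : ℂ) * pageDir l.length k := by
  sorry

/-! ## §2 (HS) PROVED from N1 + N2 (through p134969) -/

/-- **(HS) from the nodes**: N1 + N2 give the transfer form (M2-T)
(`redecomposition_of_geometric_of_belt`, p134969), which gives (HS) (`hurwitzStep_of_redecomposition`,
p134969, through `modelsOnFibred_of_transfer` p128002). [cite: GompfStipsicz1999, §8.2] -/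
theorem hs_design :
    ∀ (M : Type) [TopologicalSpace M] [T2Space M] [SecondCountableTopology M]
      [ChartedSpace (EuclideanSpace ℝ (Fin 4)) M] [IsManifold (𝓡 4) ∞ M] (g : ℕ) (l l' : IntWord g),
      ModelsOnFibred M g l → HurwitzStep (stdSymp ℤ g) l l' → ModelsOnFibred M g l' :=
  hurwitzStep_of_redecomposition (redecomposition_of_geometric_of_belt node_M2geo node_BELT)

/-! ## §3 The stabilisation side: nodes N3 (ST-geo), N3a, N3b; (ST-front) PROVED from N3 -/

/-- **N3a (ST-curve) — primitive classes are shadows of smoothly embedded page curves.**  Informal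
content: every primitive `v ∈ ℤ^{2g} = H₁(F_{g,1}; ℤ)` is the class of a non-separating simple closed
curve (Farb–Margalit, Primer, Prop. 6.2; Meyerson 1976), realised here inside the flat open page
`page g d` of `Base g` (the interior of the Milnor fibre over `‖x‖ < 2`, which contains all branch
points).  Route: `Sp(2g, ℤ) = ⟨transvections along chainVec⟩` acts transitively on primitive vectors
(algebra), the chain loops are embedded page curves (Milnor §9, `chainLoop`), Dehn twists along them
are page diffeomorphisms acting by those transvections (N1a), images of embedded curves are embedded.
Used by N3 for the block letters `(newE g + embed g c, ±)`, `(newF g, ±)` (both primitive).  Size M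
(600–1000 lines). [cite: GompfStipsicz1999, §8.2] -/
theorem node_STcurve (g : ℕ) (v : Fin g ⊕ Fin g → ℤ) (_hv : IsPrimitive v) {d : ℂ} (_hd : ‖d‖ = 1) :
    ∃ K : Metric.sphere (0 : EuclideanSpace ℝ (Fin 2)) 1 → Base g,
      Manifold.IsSmoothEmbedding (𝓡 1) (𝓡∂ 4) ∞ K ∧ (∀ θ, K θ ∈ page g d) ∧
      ∃ hK : Continuous K, shadow g K hK = v := by
  sorry

/-- **N3b (ST-embed) — the genus-raising embedding of pages realises `embed` on shadows.**  Informal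
content: there is a smooth embedding `ι` of the flat open page `page g d` of `Base g` into the flat
open page `page (g+1) d'` of `Base (g+1)` (any two unit directions) carrying the `A_{2g}` chain loops
to loops homotopic to the first `2g` chain loops of `A_{2g+2}` (Milnor 1968 §9: the Milnor fibre of
`x^{2g+1}` sits in that of `x^{2g+3}` as the complement of the last pair of vanishing cycles), so that
`shadow (g+1) (ι ∘ K) = embed g (shadow g K)` (`chainVec (g+1) i = embed g (chainVec g i)` for
`i < 2g`).  Used by N3 to re-plant the old attaching circles in the pages of `Base (g+1)` at the new
directions `pageDir (n+4) (k+4)`.  Size M (500–900 lines). [cite: GompfStipsicz1999, §8.2] -/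
theorem node_STembed (g : ℕ) {d d' : ℂ} (_hd : ‖d‖ = 1) (_hd' : ‖d'‖ = 1) :
    ∃ ι : Base g → Base (g + 1), ContMDiff (𝓡∂ 4) (𝓡∂ 4) ∞ ι ∧ InjOn ι (page g d) ∧
      MapsTo ι (page g d) (page (g + 1) d') ∧
      ∀ (K : Metric.sphere (0 : EuclideanSpace ℝ (Fin 2)) 1 → Base g) (hK : Continuous K),
        (∀ θ, K θ ∈ page g d) →
        ∃ hK' : Continuous (ι ∘ K), shadow (g + 1) (ι ∘ K) hK' = embed g (shadow g K hK) := by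
  sorry

/-- **N3 (ST-geo) — one FRONT stabilisation pair as a rebuild over `Base (g+1)`.**  Informal
content: fibred data `(X, h, D, bX, Ψ)` of `(g, l)` and an arc class `c` (primitive or `0`) yield
fibred data `(X', h', D', bX', Ψ')` of `(g+1, stabBlock g c ++ embed l)` over `Base (g+1)` — a FRESH
Lefschetz handlebody (block letters realised by N3a in the pages `pageDir (n+4) 0…3`, old letters
re-planted by N3b at `pageDir (n+4) (k+4)`, attaching maps with page twisting `∓1` along them: N3c,
`X'` by `exists_isMultiAttachment_holds`) and a FRESH page-preserving `Ψ'` — such that every gluing of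
the old data is diffeomorphic to every gluing of the new data.  Geometric source: Etnyre–Fuller 2006
§2 p. 5 ("stabilizing results in an achiral Lefschetz fibration of the same 4-manifold") with Baykur
2006 Lemma 1 (two stabilisations in an adjacent pair keep the binding connected; the block
`(e+c,+)(f,+)(f,−)(e+c,−)`); 4-dimensionally: inside the cap, `Base g = K ∪ Base(g+1)'` with
`K = (∂Base g × I) ∪ 2 one-handles ∪ 4 two-handles`, `X' := X ∪_Ψ K`, `Ψ'` read off the fibred
identification `closure(Base g ∖ K) ≅ Base (g+1)` — equivalently `M ≅ M # S⁴ # S⁴` by two cancelling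
pairs in a collar of the seam; NO Laudenbach–Poénaru (every piece explicit).  This is a REBUILD: by
the lead's rigidity finding no diffeomorphism of the old cap can re-space the `n ≥ 2` old page angles
while keeping the page clause near the binding.  Produces: all clauses of
`ModelsOnFibred M (g+1) l''` through `frontStab_of_rebuild` (§3 below; file 2 of W6).  Size XXL
(4000–6000 lines: N3a 600–1000, N3b 500–900, N3c 400–800, N3d cap cobordism + `Ψ'` + `M ≅ M'`
2500–3500; tools `IsBoundaryGluing.transfer`, `Gluing*` associativity, `MultiAttachmentData.isMultiAttachment_cons`,
`exists_isBoundaryGluing_holds`, `nonempty_diffeomorph_of_isBoundaryGluing_holds`).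
[cite: EtnyreFuller2006, §2] -/
theorem node_STgeo :
    ∀ (g : ℕ) (l : IntWord g) (c : Fin g ⊕ Fin g → ℤ), (c = 0 ∨ IsPrimitive c) →
      ∀ (X : Type) [TopologicalSpace X] [T2Space X] [SecondCountableTopology X] [CompactSpace X]
        [ChartedSpace (EuclideanHalfSpace 4) X] [IsManifold (𝓡∂ 4) ∞ X]
        (h : Fin l.length → HandleAttachingMap 3 2 (Base g))
        (D : MultiAttachmentData h (𝓡∂ 4) X) (bX : BoundaryData (𝓡∂ 4) X (𝓡 3))
        (Ψ : bX.carrier ≃ₘ⟮𝓡 3, 𝓡 3⟯ (bBase g).carrier),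
        IsLefschetzLink g l h →
        (∀ (y : bX.carrier) (a : ↥(coresComplement h)), bX.incl y = D.jA a →
          ∃ c : ℝ, 0 < c ∧ w g ((bBase g).incl (Ψ y)).1 = (c : ℂ) * w g (a : Base g).1) →
        ∃ (X' : Type) (_ : TopologicalSpace X') (_ : T2Space X') (_ : SecondCountableTopology X')
          (_ : CompactSpace X') (_ : ChartedSpace (EuclideanHalfSpace 4) X')
          (_ : IsManifold (𝓡∂ 4) ∞ X')
          (h' : Fin (stabBlock g c ++ mapWord (embed g) l).length →
            HandleAttachingMap 3 2 (Base (g + 1)))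
          (D' : MultiAttachmentData h' (𝓡∂ 4) X') (bX' : BoundaryData (𝓡∂ 4) X' (𝓡 3))
          (Ψ' : bX'.carrier ≃ₘ⟮𝓡 3, 𝓡 3⟯ (bBase (g + 1)).carrier),
          IsLefschetzLink (g + 1) (stabBlock g c ++ mapWord (embed g) l) h' ∧
          (∀ (y : bX'.carrier) (a : ↥(coresComplement h')), bX'.incl y = D'.jA a →
            ∃ c' : ℝ, 0 < c' ∧
              w (g + 1) ((bBase (g + 1)).incl (Ψ' y)).1 = (c' : ℂ) * w (g + 1) (a : Base (g + 1)).1) ∧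
          ∀ (M M' : Type) [TopologicalSpace M] [ChartedSpace (EuclideanSpace ℝ (Fin 4)) M]
            [IsManifold (𝓡 4) ∞ M] [TopologicalSpace M'] [ChartedSpace (EuclideanSpace ℝ (Fin 4)) M']
            [IsManifold (𝓡 4) ∞ M'],
            IsBoundaryGluing bX (bBase g) Ψ (𝓡 4) M → IsBoundaryGluing bX' (bBase (g + 1)) Ψ' (𝓡 4) M' →
            Nonempty (M ≃ₘ⟮𝓡 4, 𝓡 4⟯ M') := by
  sorry

/-- **(ST-front) from N3** (PROVED; this is `frontStab_of_rebuild` of W6 file 2): glue the new data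
(`exists_isBoundaryGluing_holds`), read off a fibred model of the glued manifold
(`modelsOnFibred_of_data`), move it to `M` along the diffeomorphism of N3
(`ModelsOnFibred.of_diffeomorph`, Hirsch 1976 §8.2). [cite: EtnyreFuller2006, §2] -/
theorem st_design :
    ∀ (M : Type) [TopologicalSpace M] [T2Space M] [SecondCountableTopology M]
      [ChartedSpace (EuclideanSpace ℝ (Fin 4)) M] [IsManifold (𝓡 4) ∞ M] (g : ℕ) (l : IntWord g)
      (c : Fin g ⊕ Fin g → ℤ), (c = 0 ∨ IsPrimitive c) → ModelsOnFibred M g l →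
      ModelsOnFibred M (g + 1) (stabBlock g c ++ mapWord (embed g) l) := by
  intro M _ _ _ _ _ g l c hc hM
  obtain ⟨X, _, _, _, _, _, _, h, D, bX, Ψ, hlink, hglue, hpage⟩ := hM
  obtain ⟨X', _, _, _, _, _, _, h', D', bX', Ψ', hlink', hpage', hdiff⟩ :=
    node_STgeo g l c hc X h D bX Ψ hlink hpage
  obtain ⟨P, _, _, _, _, _, _, hglueP⟩ := exists_isBoundaryGluing_holds bX' (bBase (g + 1)) Ψ'
  have hP : ModelsOnFibred P (g + 1) (stabBlock g c ++ mapWord (embed g) l) :=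
    modelsOnFibred_of_data hlink' D' bX' Ψ' hglueP hpage'
  obtain ⟨e⟩ := hdiff M P hglue hglueP
  exact ModelsOnFibred.of_diffeomorph hP e.symm

/-! ## §4 TOP: the registered NF4 signature, PROVED from p114135 + (HS) + (ST-front) -/

/-- **NF4 as registered (`stub_modelsOnFibred_of_reach` = `LefschetzBase.modelsOnFibred_of_reach`),
from the nodes**: `Reach` is generated by signed Hurwitz moves and front stabilisations
(`stub_modelsOnFibred_of_reach_of_front`, p114135); (HS) = `hs_design` (N1 + N2), (ST-front) =
`st_design` (N3).  Baykur 2006 §5 p. 13 and Lemma 1, Etnyre–Fuller 2006 §2, Gompf–Stipsicz 1999 §8.2.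
[cite: Baykur2006, Lemma 1 and §5 p. 13] -/
theorem nf4_design :
    ∀ (M : Type) [TopologicalSpace M] [T2Space M] [SecondCountableTopology M]
      [ChartedSpace (EuclideanSpace ℝ (Fin 4)) M] [IsManifold (𝓡 4) ∞ M] (g : ℕ) (l : IntWord g)
      (g' : ℕ) (l' : IntWord g'),
      ModelsOnFibred M g l → Reach g l g' l' → ModelsOnFibred M g' l' :=
  stub_modelsOnFibred_of_reach_of_front hs_design st_design

end NF4Design

end Summit.SmoothPoincare4.SmoothPoincare4.Theorems.AcyclicBisectionExists.ModpBraidOrbits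

end
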